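import Summits.Parity.GeneralizedHardyLittlewood.Theses.LeeYangFibres

/-!
# Disproof of `FibreHyperbolicity` (stmt-Parity-14108, route LeeYangFibres) — standing adversary file

Crux (informal): for all `t ≥ 1, L, u₀, η > 0` there are `u ≥ max(u₀,2)` and `N₀` such that for
`N ≥ N₀`, every non-degenerate `d = 1` system `Ψ` (‖Ψ‖_N ≤ L), every convex `K ⊆ [-N,N]` with
`β_∞(Ψ,K)·𝔖(Ψ) ≥ ηN`, every coordinate `i` and every frozen fugacity vector `w ∈ (0,1]^t`, the fibre
polynomial `ζ ↦ Σ_{j ∈ [1,u]^t} C_j ζ^{j_i} ∏_{k≠i} w_k^{j_k}` (joint rough Ω-cells `C_j`) has only real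
zeros.

## Findings (index; details in the docstrings below)

* `fibreHyperbolicity_iff` — the crux restated through `cell` / `fibre` (`Iff.rfl`).
* (a) LOAD-BEARING `ηN ≤ β_∞𝔖`: `false_without_archMass : ¬ WithoutArchMass` (K = ∅ makes the fibre
  the zero polynomial; any proof must turn the arch-mass hypothesis into NON-EMPTINESS of some cell,
  i.e. it contains a sieve lower bound — `cells_nonempty_of_fibreHyperbolicity`).
* (b) LOAD-BEARING `0 < w_k`: `fibre_eq_zero_of_fugacity_zero` / `conclusion_fails_of_fugacity_zero`
  (a frozen fugacity 0 on a coordinate `k ≠ i` kills every monomial since `j_k ≥ 1`; the "other forms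
  prime" regime is the LIMIT `w → 0⁺`, never the value `w = 0`).
* (c) `conclusion_false_of_fibre_zero`: whenever the fibre is the zero polynomial the conclusion fails
  at `ζ = I`; `fibre_zero`: `ζ = 0` is always a root (harmless).
* (d) LOAD-BEARING `Convex ℝ K`: `false_without_convexity : ¬ WithoutConvexity` — `K = [0,N]`
  punctured at every lattice point except a prime `p ∈ (N/2,N]` and a prime cube `q³ ≤ N < q⁴`
  (Bertrand twice): `β_∞ = N`, `𝔖 = 1`, fibre `ζ + ζ³`, root `I`.  Tools: `fibre_t1_points`
  (sum-over-points form of `t = 1` fibres), `archFactor_idSys_puncturedBox` (lattice points are null).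
* (T) `toy_fibre_nonreal`: the explicit `N = 130`, `u = 4`, `Ψ = (n,n+2)`, `K = [100,130]` cell pattern
  is non-hyperbolic for every `w ∈ (0,1]` — the `∃ N₀` is load-bearing (finite checks are noise).
* (C) KILL CRITERION AS A THEOREM: `cofinalModel_of_fibreHyperbolicity : FibreHyperbolicity →
  CofinalModelHyperbolicity` and `not_fibreHyperbolicity_of_not_cofinalModel` — the `t = 1` instance
  `ψ(n) = n`, `K = [0,x]`, `η = 1` is admissible (`singularProduct_idSys : 𝔖 = 1`,
  `archFactor_idSys_boxK : β_∞ = x`, sorry-free) and its fibre IS ModelHyperbolicity's polynomial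
  (`model_sum_eq_fibre`); so complex zeros of `Σ_j A_j(x) z^j` for all large `u` (at unbounded `x`)
  refute the crux, and conversely any proof of the crux proves crux 4 cofinally in `u`.
* LINE `SketchIdeator1` (picked 10:30Z, 2026-08-16): all stubs landed but `stub_ghostFree` (`t ≥ 2` ghost-free
  HL cell law); crux 4 PROVED in the tree (`ModelHyperbolicity_of`), crux at `t = 1` PROVED
  (`fibreHyperbolicityAt_one`); typing audit of the open stub at the end of this file: no misstatement,
  HL-complete residue.
* WHY IT RESISTS (cycle 1): in the Hardy–Littlewood world every cell is `C_j = M·∏_k a_{j_k}·(1+o(1))`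
  (rank one), so every fibre is a coefficientwise-relative `o(1)` perturbation of
  `M ∏_{k≠i} F_N(w_k) · F_N(ζ)`, `F_N(ζ) = Σ_m (A_m(N)/N) ζ^m → (1/log N)·F(u,ζ)`,
  `F(u,ζ) = Σ_j I_j(u) ζ^j` (Buchstab–Dickman Ω-cell densities, `I₁ = 1`,
  `∂_u I_j(u) = I_{j-1}(u-1)/(u-1)`); hence FH(u) ⟺ (morally) `F(u,·)` real-rooted with simple zeros,
  and the crux ⟺ that cofinally in `u`.  Laplace picture: `F(u,z)/u = L⁻¹[exp(z E₁(s)) − 1](u)`;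
  for `z = −x`, `κ = x/u < 1/e`: edge integral along the cut (max at `σ₁`, `σe^{−σ} = κ`) gives
  `−(sin πx/π)A`, the arc end-point at the pass `−σ₂` gives `+(cos πx/π)P` — IN QUADRATURE, so
  `π F(u,−x)/u = R cos(πx+θ)`, `R = √(A²+P²) > 0` with `A ≫ P` until the saddles merge at `x ≈ u/e`:
  zeros at `−k − atan(P/A)/π` (exponentially close to `−k`) for ALL `k ≲ u/e`, then an Airy window, a
  single conjugate-saddle (Lambert `W₀/W₋₁`) oscillation with spreading zeros, and a lacunary top
  (`I_{u-r}(u) ≍ u r^{u-r-1}/((u-r)!(u-r-1)!)`, largest zero `≈ −0.05·2^u u²`) overlapping it.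
  VALIDATED: kit j014022 — predicted `x_k − k` and `F(u,−k) = (−1)^k uP(k)/π` match the certified
  zeros to 3 digits (u = 20..80, e.g. u = 80, k = 26: 3.904e−4 vs 3.952e−4); kit j013962 — EVERY
  integer `u ≤ 160` (and half-integers ≤ 40) is real-rooted with simple zeros (FLINT-certified on the
  150-digit-rounded integer polynomial), `k(u) = ⌊u/e⌋ − O(1)` (59 at u = 160), margin
  `δ(u) ≈ 6·10^{−0.41u}` (2e−65 at u = 160; = planner's θ*(u) at u = 4..8); kit j014024 — every
  `u ∈ {165,170,…,300} ∪ {296..300}` real-rooted & simple (250 digits; `δ(300) = 1.1e−122`,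
  `k(300) = 110 ≈ 300/e`); kit j014034/j016361 — crux 4 AT FINITE x, exhaustive `x ≤ 10⁷`: real-rooted
  for every `x ≥ 480 (u=4)`, `≥ 16802 (u=5)`, and EXACTLY from `x = 7^u − 1` on for `u = 6, 7, 8`
  (last failures `7⁶−2, 7⁷−2, 7⁸−2`; u = 9, 10 fail throughout `x ≤ 10⁷ < 7⁹`): the finite-`x` "noise"
  is the small-prime circle phenomenon and ends once `2,3,5,7` are all sieved (`x^{1/u} ≥ 7`).  No structural kill as typed: `𝔖 > 0` excludes local
  obstructions, `toNat`/`minFac` junk is excluded once `N ≥ 2^u`, all rough values have `Ω ≤ u` once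
  `N > L^u`, `singularProduct` converges for non-degenerate systems (no `limUnder` junk).
-/

noncomputable section

open Literature.NumberTheory.Sieve
open scoped Classical BigOperators

namespace Summit.Parity.GeneralizedHardyLittlewood.Cruxes.FibreHyperbolicity.Disproof

open MeasureTheory
open Summit.Parity.GeneralizedHardyLittlewood.Theses.LeeYangFibres (FibreHyperbolicity ModelHyperbolicity)

/-- The joint rough Ω-cell count `C_j(Ψ, K, N, u) = #{n ∈ K ∩ ℤ : N^{1/u} < P⁻(ψ_k(n)), Ω(ψ_k(n)) = j_k ∀ k}`
(verbatim sub-term of the crux). -/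
def cell (t u N : ℕ) (Ψ : Fin t → AffLinForm 1) (K : Set (Fin 1 → ℝ)) (j : Fin t → ℕ) : ℕ :=
  ((latticeBox 1 N).filter (fun n => realPoint n ∈ K ∧ ∀ k, (N : ℝ) ^ ((1 : ℝ) / u) <
    (Nat.minFac ((Ψ k).eval n).toNat : ℝ) ∧ ArithmeticFunction.cardFactors ((Ψ k).eval n).toNat = j k)).card

/-- The fibre polynomial of coordinate `i` with frozen fugacities `w`, evaluated at `ζ`
(verbatim sub-term of the crux). -/
def fibre (t u N : ℕ) (Ψ : Fin t → AffLinForm 1) (K : Set (Fin 1 → ℝ)) (i : Fin t) (w : Fin t → ℝ)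
    (ζ : ℂ) : ℂ :=
  ∑ j ∈ Fintype.piFinset (fun _ : Fin t => Finset.Icc 1 u),
    ((cell t u N Ψ K j : ℕ) : ℂ) * ∏ k, (if k = i then ζ else ((w k : ℝ) : ℂ)) ^ (j k)

/-- The crux, read through `cell`/`fibre`; definitional. -/
theorem fibreHyperbolicity_iff :
    FibreHyperbolicity ↔ ∀ (t L u₀ : ℕ), 1 ≤ t → ∀ η : ℝ, 0 < η → ∃ u : ℕ, u₀ ≤ u ∧ 2 ≤ u ∧
      ∃ N₀ : ℕ, ∀ N : ℕ, N₀ ≤ N → ∀ Ψ : Fin t → AffLinForm 1, IsNondegenerateSystem Ψ →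
      affLinSize Ψ N ≤ L → ∀ K : Set (Fin 1 → ℝ), Convex ℝ K → K ⊆ realBox 1 N →
      η * (N : ℝ) ≤ archFactor Ψ K * singularProduct Ψ → ∀ i : Fin t, ∀ w : Fin t → ℝ,
      (∀ k, 0 < w k ∧ w k ≤ 1) → ∀ ζ : ℂ, fibre t u N Ψ K i w ζ = 0 → ζ.im = 0 :=
  Iff.rfl

/-! ### (c) the zero-polynomial degenerate case -/

/-- `ζ = 0` is always a root of a fibre (every monomial has `j_i ≥ 1`); harmless. -/
theorem fibre_zero (t u N : ℕ) (Ψ : Fin t → AffLinForm 1) (K : Set (Fin 1 → ℝ)) (i : Fin t)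
    (w : Fin t → ℝ) : fibre t u N Ψ K i w 0 = 0 := by
  unfold fibre
  refine Finset.sum_eq_zero fun j hj => ?_
  have hj1 : 1 ≤ j i := (Finset.mem_Icc.mp (Fintype.mem_piFinset.mp hj i)).1
  have : (∏ k, (if k = i then (0 : ℂ) else ((w k : ℝ) : ℂ)) ^ (j k)) = 0 := by
    apply Finset.prod_eq_zero (Finset.mem_univ i)
    simp only [if_true]
    exact zero_pow (by omega)
  rw [this, mul_zero]

/-- If every cell vanishes the fibre is the zero polynomial … -/
theorem fibre_eq_zero_of_cells (t u N : ℕ) (Ψ : Fin t → AffLinForm 1) (K : Set (Fin 1 → ℝ))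
    (i : Fin t) (w : Fin t → ℝ) (h : ∀ j ∈ Fintype.piFinset (fun _ : Fin t => Finset.Icc 1 u),
      cell t u N Ψ K j = 0) (ζ : ℂ) : fibre t u N Ψ K i w ζ = 0 := by
  unfold fibre
  refine Finset.sum_eq_zero fun j hj => ?_
  rw [h j hj, Nat.cast_zero, zero_mul]

/-- … and then the conclusion of the crux fails at `ζ = I`: a proof of FH must show that, for its
own `u, N₀`, every admissible `(N, Ψ, K)` has a non-empty joint rough cell. -/
theorem conclusion_false_of_fibre_zero (t u N : ℕ) (Ψ : Fin t → AffLinForm 1) (K : Set (Fin 1 → ℝ))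
    (i : Fin t) (w : Fin t → ℝ) (h : ∀ ζ : ℂ, fibre t u N Ψ K i w ζ = 0) :
    ¬ ∀ ζ : ℂ, fibre t u N Ψ K i w ζ = 0 → ζ.im = 0 := by
  intro hc
  have := hc Complex.I (h _)
  simp at this

/-- FH ⇒ (for its own `u, N₀`) every admissible `(N, Ψ, K)` has SOME non-empty joint rough Ω-cell:
the crux formally contains a sieve lower bound (rough tuples in every convex `K` with
`ηN ≤ β_∞ 𝔖`). -/
theorem cells_nonempty_of_fibreHyperbolicity (hFH : FibreHyperbolicity) (t L u₀ : ℕ) (ht : 1 ≤ t)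
    (η : ℝ) (hη : 0 < η) : ∃ u : ℕ, u₀ ≤ u ∧ 2 ≤ u ∧ ∃ N₀ : ℕ, ∀ N : ℕ, N₀ ≤ N →
      ∀ Ψ : Fin t → AffLinForm 1, IsNondegenerateSystem Ψ → affLinSize Ψ N ≤ L →
      ∀ K : Set (Fin 1 → ℝ), Convex ℝ K → K ⊆ realBox 1 N →
      η * (N : ℝ) ≤ archFactor Ψ K * singularProduct Ψ →
      ∃ j ∈ Fintype.piFinset (fun _ : Fin t => Finset.Icc 1 u), cell t u N Ψ K j ≠ 0 := by
  obtain ⟨u, hu₀, hu2, N₀, hN⟩ := hFH t L u₀ ht η hη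
  refine ⟨u, hu₀, hu2, N₀, fun N hNN Ψ hΨ hL K hK hKN hmass => ?_⟩
  by_contra hne
  push Not at hne
  have ht0 : 0 < t := ht
  exact conclusion_false_of_fibre_zero t u N Ψ K ⟨0, ht0⟩ (fun _ => 1)
    (fibre_eq_zero_of_cells t u N Ψ K ⟨0, ht0⟩ (fun _ => 1) hne)
    (hN N hNN Ψ hΨ hL K hK hKN hmass ⟨0, ht0⟩ (fun _ => 1) fun _ => ⟨one_pos, le_rfl⟩)

/-! ### (a) the arch-mass hypothesis `ηN ≤ β_∞ 𝔖` is load-bearing -/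

/-- FH with the hypothesis `η * N ≤ archFactor Ψ K * singularProduct Ψ` deleted (so `η` disappears). -/
def WithoutArchMass : Prop :=
  ∀ (t L u₀ : ℕ), 1 ≤ t → ∃ u : ℕ, u₀ ≤ u ∧ 2 ≤ u ∧ ∃ N₀ : ℕ, ∀ N : ℕ, N₀ ≤ N →
    ∀ Ψ : Fin t → AffLinForm 1, IsNondegenerateSystem Ψ → affLinSize Ψ N ≤ L →
    ∀ K : Set (Fin 1 → ℝ), Convex ℝ K → K ⊆ realBox 1 N → ∀ i : Fin t, ∀ w : Fin t → ℝ,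
    (∀ k, 0 < w k ∧ w k ≤ 1) → ∀ ζ : ℂ, fibre t u N Ψ K i w ζ = 0 → ζ.im = 0

/-- The `t = 1` system `ψ(n) = n`. -/
def idSys : Fin 1 → AffLinForm 1 := fun _ => ⟨fun _ => 1, 0⟩

/-- `ψ(n) = n` is a non-degenerate system (one non-constant form). [folklore] -/
theorem idSys_isNondegenerate : IsNondegenerateSystem idSys := by
  refine ⟨fun i h => ?_, fun i j hij => absurd (Subsingleton.elim i j) hij⟩
  have := congrFun h 0
  simp [idSys] at this

/-- `‖(n ↦ n)‖_N = 1`. [folklore] -/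
theorem affLinSize_idSys (N : ℝ) : affLinSize idSys N = 1 := by
  simp [affLinSize, idSys]

/-- Every cell over `K = ∅` is empty. [folklore] -/
theorem cell_emptyset (t u N : ℕ) (Ψ : Fin t → AffLinForm 1) (j : Fin t → ℕ) :
    cell t u N Ψ ∅ j = 0 := by
  simp [cell]

/-- **Load-bearing (a).** Without `ηN ≤ β_∞𝔖` the statement is false: `t = 1`, `ψ(n) = n`, `K = ∅`
(convex, inside the box) has all cells empty, the fibre is the zero polynomial and `ζ = I` is a
root.  Witness independent of `u, N₀`. -/
theorem false_without_archMass : ¬ WithoutArchMass := by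
  intro h
  obtain ⟨u, -, -, N₀, hN⟩ := h 1 1 0 le_rfl
  have key := hN N₀ le_rfl idSys idSys_isNondegenerate (by rw [affLinSize_idSys]; simp) ∅
    convex_empty (Set.empty_subset _) 0 (fun _ => 1) (fun _ => ⟨one_pos, le_rfl⟩) Complex.I
    (fibre_eq_zero_of_cells 1 u N₀ idSys ∅ 0 (fun _ => 1) (fun j _ => cell_emptyset 1 u N₀ idSys j) _)
  simp at key

/-! ### (b) positivity of the frozen fugacities is load-bearing -/

/-- A frozen fugacity `w_k = 0` on a coordinate `k ≠ i` kills every monomial (`j_k ≥ 1`). -/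
theorem fibre_eq_zero_of_fugacity_zero (t u N : ℕ) (Ψ : Fin t → AffLinForm 1)
    (K : Set (Fin 1 → ℝ)) {i k : Fin t} (hki : k ≠ i) {w : Fin t → ℝ} (hw : w k = 0) (ζ : ℂ) :
    fibre t u N Ψ K i w ζ = 0 := by
  unfold fibre
  refine Finset.sum_eq_zero fun j hj => ?_
  have hj1 : 1 ≤ j k := (Finset.mem_Icc.mp (Fintype.mem_piFinset.mp hj k)).1
  have : (∏ k', (if k' = i then ζ else ((w k' : ℝ) : ℂ)) ^ (j k')) = 0 := by
    apply Finset.prod_eq_zero (Finset.mem_univ k)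
    rw [if_neg hki, hw, Complex.ofReal_zero]
    exact zero_pow (by omega)
  rw [this, mul_zero]

/-- **Load-bearing (b).** With a closed fugacity cube `[0,1]^t` (`t ≥ 2`) the conclusion fails for
EVERY `(N, Ψ, K)`: put `w_k = 0` on some `k ≠ i`.  So "the other forms prime" (`w → 0⁺`) enters
only as a limit of the open-cube statement. -/
theorem conclusion_fails_of_fugacity_zero (t u N : ℕ) (Ψ : Fin t → AffLinForm 1)
    (K : Set (Fin 1 → ℝ)) {i k : Fin t} (hki : k ≠ i) {w : Fin t → ℝ} (hw : w k = 0) :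
    ¬ ∀ ζ : ℂ, fibre t u N Ψ K i w ζ = 0 → ζ.im = 0 :=
  conclusion_false_of_fibre_zero t u N Ψ K i w (fibre_eq_zero_of_fugacity_zero t u N Ψ K hki hw)

/-- The closed-cube variant of the crux (only change: `0 ≤ w k`). -/
def WithClosedFugacities : Prop :=
  ∀ (t L u₀ : ℕ), 1 ≤ t → ∀ η : ℝ, 0 < η → ∃ u : ℕ, u₀ ≤ u ∧ 2 ≤ u ∧
    ∃ N₀ : ℕ, ∀ N : ℕ, N₀ ≤ N → ∀ Ψ : Fin t → AffLinForm 1, IsNondegenerateSystem Ψ →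
    affLinSize Ψ N ≤ L → ∀ K : Set (Fin 1 → ℝ), Convex ℝ K → K ⊆ realBox 1 N →
    η * (N : ℝ) ≤ archFactor Ψ K * singularProduct Ψ → ∀ i : Fin t, ∀ w : Fin t → ℝ,
    (∀ k, 0 ≤ w k ∧ w k ≤ 1) → ∀ ζ : ℂ, fibre t u N Ψ K i w ζ = 0 → ζ.im = 0

/-- The closed-cube variant fails as soon as ONE admissible datum with `t ≥ 2` exists (which is the
case: e.g. `Ψ = (n, n+2)`, `K = [0,N]`, `𝔖 = 2C₂ > 0`; the singular-product evaluation is not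
formalised here, so the statement is kept relative). -/
theorem false_with_closed_fugacities_of_admissible
    (hadm : ∀ u N₀ : ℕ, ∃ N, N₀ ≤ N ∧ ∃ Ψ : Fin 2 → AffLinForm 1, IsNondegenerateSystem Ψ ∧
      affLinSize Ψ N ≤ (4 : ℕ) ∧ ∃ K : Set (Fin 1 → ℝ), Convex ℝ K ∧ K ⊆ realBox 1 N ∧
      (1 : ℝ) * (N : ℝ) ≤ archFactor Ψ K * singularProduct Ψ) :
    ¬ WithClosedFugacities := by
  intro h
  obtain ⟨u, -, -, N₀, hN⟩ := h 2 4 0 (by norm_num) 1 one_pos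
  obtain ⟨N, hNN, Ψ, hΨ, hL, K, hK, hKN, hmass⟩ := hadm u N₀
  have h01 : (1 : Fin 2) ≠ 0 := by decide
  exact conclusion_fails_of_fugacity_zero 2 u N Ψ K h01 (w := fun k => if k = 0 then 1 else 0)
    (by simp) (hN N hNN Ψ hΨ hL K hK hKN hmass 0 _ fun k => by fin_cases k <;> simp)

/-! ### (C) the formal kill criterion: FH ⇒ cofinal ModelHyperbolicity -/

/-- `ψ(n) = n` evaluates to the coordinate. [folklore] -/
theorem idSys_eval (k : Fin 1) (n : Fin 1 → ℤ) : (idSys k).eval n = n 0 := by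
  simp [idSys, AffLinForm.eval]

/-- The real extension of `ψ(n) = n` is the coordinate. [folklore] -/
theorem idSys_realEval (k : Fin 1) (v : Fin 1 → ℝ) : (idSys k).realEval v = v 0 := by
  simp [idSys, AffLinForm.realEval]

attribute [simp] idSys_eval idSys_realEval

/-! #### the model instance: `ψ(n) = n`, `K = [0, x]` -/

/-- `K = [0,x]` as a subset of `ℝ¹`. -/
def boxK (x : ℕ) : Set (Fin 1 → ℝ) := Set.Icc 0 (fun _ => (x : ℝ))

/-- `[0,x]` is convex. [folklore] -/
theorem convex_boxK (x : ℕ) : Convex ℝ (boxK x) := convex_Icc _ _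

/-- `[0,x] ⊆ [-x,x]`. [folklore] -/
theorem boxK_subset_realBox (x : ℕ) : boxK x ⊆ realBox 1 x := by
  refine Set.Icc_subset_Icc ?_ le_rfl
  intro i
  simp

/-- `localFactor` of `ψ(n) = n` is `1` at every modulus `q ≥ 1`. -/
theorem localFactor_idSys {q : ℕ} (hq : 0 < q) : localFactor idSys q = 1 := by
  rw [localFactor, sum_piFinset_fin_one]
  have hφ : 0 < Nat.totient q := Nat.totient_pos.mpr hq
  have hcard : ((Finset.range q).filter (fun m : ℕ => Int.gcd (m : ℤ) q = 1)).card = Nat.totient q := by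
    rw [Nat.totient_eq_card_coprime]
    congr 1
    ext m
    simp only [Finset.mem_filter, Int.gcd_natCast_natCast, Nat.coprime_iff_gcd_eq_one, Nat.gcd_comm]
  have hsum : ∑ m ∈ Finset.range q, (∏ _i : Fin 1, localVonMangoldt q ((m : ℕ) : ℤ)) =
      (Nat.totient q : ℝ) * ((q : ℝ) / Nat.totient q) := by
    simp only [Finset.prod_const, Finset.card_univ, Fintype.card_fin, pow_one, localVonMangoldt]
    rw [Finset.sum_ite, Finset.sum_const_zero, add_zero, Finset.sum_const, nsmul_eq_mul, hcard]
  simp only [idSys_eval]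
  rw [hsum]
  have hq' : (q : ℝ) ≠ 0 := by exact_mod_cast hq.ne'
  have hφ' : (Nat.totient q : ℝ) ≠ 0 := by exact_mod_cast hφ.ne'
  field_simp

/-- All partial singular products of `ψ(n) = n` equal `1`. [folklore] -/
theorem singularProductPartial_idSys (x : ℕ) : singularProductPartial idSys x = 1 := by
  unfold singularProductPartial
  refine Finset.prod_eq_one fun p hp => localFactor_idSys ?_
  have : p.Prime := (Nat.mem_primesLE.mp hp).2
  exact this.pos

/-- `𝔖(n ↦ n) = 1` (the `limUnder` of the constant sequence `1`). [folklore] -/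
theorem singularProduct_idSys : singularProduct idSys = 1 := by
  unfold singularProduct
  have : singularProductPartial idSys = fun _ => (1 : ℝ) := funext singularProductPartial_idSys
  rw [this]
  exact tendsto_const_nhds.limUnder_eq

/-- `β_∞(n ↦ n, [0,x]) = vol((0,x]) = x`. [cite: GreenTao2010, (1.4)] -/
theorem archFactor_idSys_boxK (x : ℕ) : archFactor idSys (boxK x) = x := by
  unfold archFactor
  have hset : boxK x ∩ {v : Fin 1 → ℝ | ∀ i, 0 < (idSys i).realEval v} =
      Set.pi Set.univ (fun _ : Fin 1 => Set.Ioc (0 : ℝ) x) := by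
    ext v
    simp only [boxK, Set.mem_inter_iff, Set.mem_Icc, Pi.le_def, Pi.zero_apply, Set.mem_setOf_eq,
      idSys_realEval, Set.mem_pi, Set.mem_univ, true_implies, Set.mem_Ioc, Fin.forall_fin_one]
    constructor
    · rintro ⟨⟨-, h2⟩, h3⟩
      exact ⟨h3, h2⟩
    · rintro ⟨h1, h2⟩
      exact ⟨⟨h1.le, h2⟩, h1⟩
  rw [hset, Real.volume_pi_Ioc]
  simp

/-- The hypotheses of FH hold for (`t = 1`, `L = 1`, `η = 1`, `ψ(n) = n`, `K = [0,x]`). -/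
theorem archMass_idSys_boxK (x : ℕ) :
    (1 : ℝ) * (x : ℝ) ≤ archFactor idSys (boxK x) * singularProduct idSys := by
  rw [archFactor_idSys_boxK, singularProduct_idSys]
  simp

/-! #### the fibre of the model instance is the model cell polynomial -/

/-- `A_m(x) = #{1 ≤ n ≤ x : x^{1/u} < P⁻(n), Ω(n) = m}` (ModelHyperbolicity's coefficient). -/
def modelCell (u x m : ℕ) : ℕ :=
  ((Finset.Icc 1 x).filter (fun n => (x : ℝ) ^ ((1 : ℝ) / u) < (Nat.minFac n : ℝ) ∧
    ArithmeticFunction.cardFactors n = m)).card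

/-- Crux 4 read through `modelCell`; definitional. [folklore] -/
theorem modelHyperbolicity_iff : ModelHyperbolicity ↔ ∀ u : ℕ, 2 ≤ u → ∃ x₀ : ℕ, ∀ x : ℕ, x₀ ≤ x →
    ∀ z : ℂ, (∑ j ∈ Finset.range (u + 1), ((modelCell u x j : ℕ) : ℂ) * z ^ j) = 0 → z.im = 0 :=
  Iff.rfl

/-- The `t = 1` fibre is the one-variable cell polynomial `Σ_m C_m z^m`. [folklore] -/
theorem fibre_idSys (u x : ℕ) (w : Fin 1 → ℝ) (z : ℂ) :
    fibre 1 u x idSys (boxK x) 0 w z =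
      ∑ m ∈ Finset.Icc 1 u, ((cell 1 u x idSys (boxK x) (fun _ => m) : ℕ) : ℂ) * z ^ m := by
  unfold fibre
  rw [sum_piFinset_fin_one]
  simp

/-- The cells of (`ψ(n) = n`, `K = [0,x]`) are ModelHyperbolicity's `A_m(x)` (`m ≥ 1`):
bijection `n ↦ n.toNat` between `{n ∈ [-x,x] ∩ ℤ : n ∈ [0,x], rough, Ω = m}` and `{1 ≤ n ≤ x : rough, Ω = m}`.
[folklore] -/
theorem cell_idSys (u x m : ℕ) (hm : 1 ≤ m) :
    cell 1 u x idSys (boxK x) (fun _ => m) = modelCell u x m := by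
  unfold cell modelCell
  refine Finset.card_nbij' (fun n => (n 0).toNat) (fun n' _ => (n' : ℤ)) ?_ ?_ ?_ ?_
  · intro n hn
    simp only [Finset.coe_filter, Set.mem_setOf_eq, Fin.forall_fin_one, idSys_eval, boxK,
      Set.mem_Icc, Pi.le_def, Pi.zero_apply, realPoint] at hn
    obtain ⟨-, ⟨h0, hx⟩, hr, hΩ⟩ := hn
    simp only [Finset.coe_filter, Set.mem_setOf_eq, Finset.mem_Icc]
    refine ⟨⟨?_, ?_⟩, hr, hΩ⟩
    · by_contra h
      have h0' : (n 0).toNat = 0 := by omega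
      rw [h0', ArithmeticFunction.cardFactors_zero] at hΩ
      omega
    · have : (n 0 : ℝ) ≤ (x : ℝ) := hx
      have : n 0 ≤ (x : ℤ) := by exact_mod_cast this
      exact Int.toNat_le.mpr this
  · intro n' hn'
    simp only [Finset.coe_filter, Set.mem_setOf_eq, Finset.mem_Icc] at hn'
    obtain ⟨⟨h1, hx⟩, hr, hΩ⟩ := hn'
    simp only [Finset.coe_filter, Set.mem_setOf_eq, Fin.forall_fin_one, idSys_eval, boxK,
      Set.mem_Icc, Pi.le_def, Pi.zero_apply, realPoint, latticeBox, Fintype.mem_piFinset,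
      Finset.mem_Icc, Int.toNat_natCast]
    refine ⟨⟨by omega, by exact_mod_cast hx⟩, ⟨by positivity, by exact_mod_cast hx⟩, hr, hΩ⟩
  · intro n hn
    simp only [Finset.coe_filter, Set.mem_setOf_eq, Fin.forall_fin_one, boxK, Set.mem_Icc,
      Pi.le_def, Pi.zero_apply, realPoint] at hn
    obtain ⟨-, ⟨h0, -⟩, -⟩ := hn
    funext k
    have hk : k = 0 := Subsingleton.elim k 0
    subst hk
    have : (0 : ℝ) ≤ (n 0 : ℝ) := h0
    have h0' : 0 ≤ n 0 := by exact_mod_cast this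
    simp [Int.toNat_of_nonneg h0']
  · intro n' _
    simp

/-- `A_0(x) = 0` for `x ≥ 1`: `Ω(n) = 0` forces `n = 1`, and `P⁻(1) = 1 ≤ x^{1/u}`. [folklore] -/
theorem modelCell_zero (u x : ℕ) (hx : 1 ≤ x) : modelCell u x 0 = 0 := by
  unfold modelCell
  rw [Finset.card_eq_zero, Finset.filter_eq_empty_iff]
  intro n hn
  simp only [Finset.mem_Icc] at hn
  rintro ⟨hr, hΩ⟩
  rw [ArithmeticFunction.cardFactors_apply, List.length_eq_zero_iff, Nat.primeFactorsList_eq_nil] at hΩ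
  rcases hΩ with h | h
  · omega
  · subst h
    have h1 : (1 : ℝ) ≤ (x : ℝ) ^ ((1 : ℝ) / u) :=
      Real.one_le_rpow (by exact_mod_cast hx) (by positivity)
    rw [Nat.minFac_one, Nat.cast_one] at hr
    linarith

/-- ModelHyperbolicity's polynomial `Σ_{j ≤ u} A_j(x) z^j` equals the fibre of the model instance
(`w` is irrelevant at `t = 1`). [folklore] -/
theorem model_sum_eq_fibre (u x : ℕ) (hx : 1 ≤ x) (z : ℂ) :
    (∑ j ∈ Finset.range (u + 1), ((modelCell u x j : ℕ) : ℂ) * z ^ j) =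
      fibre 1 u x idSys (boxK x) 0 (fun _ => 1) z := by
  rw [fibre_idSys, Finset.sum_range_succ', modelCell_zero u x hx]
  simp only [Nat.cast_zero, zero_mul, add_zero, pow_zero]
  rw [Finset.range_eq_Ico, Finset.sum_Ico_add' (fun j => ((modelCell u x j : ℕ) : ℂ) * z ^ j) 0 u 1]
  simp only [zero_add]
  rw [show Finset.Ico 1 (u + 1) = Finset.Icc 1 u from rfl]
  refine Finset.sum_congr rfl fun m hm => ?_
  rw [cell_idSys u x m (Finset.mem_Icc.mp hm).1]

/-! #### the reduction -/

/-- Cofinal form of ModelHyperbolicity's conclusion. -/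
def CofinalModelHyperbolicity : Prop :=
  ∀ u₀ : ℕ, ∃ u : ℕ, u₀ ≤ u ∧ 2 ≤ u ∧ ∃ x₀ : ℕ, ∀ x : ℕ, x₀ ≤ x →
    ∀ z : ℂ, (∑ j ∈ Finset.range (u + 1), ((modelCell u x j : ℕ) : ℂ) * z ^ j) = 0 → z.im = 0

/-- Crux 4 as filed (every `u ≥ 2`) implies its cofinal form. [folklore] -/
theorem cofinal_of_modelHyperbolicity (h : ModelHyperbolicity) : CofinalModelHyperbolicity := by
  intro u₀
  obtain ⟨x₀, hx₀⟩ := h (max u₀ 2) (le_max_right _ _)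
  exact ⟨max u₀ 2, le_max_left _ _, le_max_right _ _, x₀, hx₀⟩

/-- **Kill criterion, formal.** `FibreHyperbolicity` implies the cofinal model hyperbolicity: its
`t = 1` instance `ψ(n) = n`, `K = [0, x]`, `η = 1` (`β_∞ = x`, `𝔖 = 1`) has as fibre exactly
ModelHyperbolicity's polynomial `Σ_j A_j(x) z^j`.  Hence complex zeros of the rough-integer cell
polynomial for ALL large `u` (at arbitrarily large `x`) refute the crux. -/
theorem cofinalModel_of_fibreHyperbolicity (h : FibreHyperbolicity) : CofinalModelHyperbolicity := by
  intro u₀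
  obtain ⟨u, hu₀, hu2, N₀, hN⟩ := h 1 1 u₀ le_rfl 1 one_pos
  refine ⟨u, hu₀, hu2, max N₀ 1, fun x hx z hz => ?_⟩
  have hxN : N₀ ≤ x := le_trans (le_max_left _ _) hx
  have hx1 : 1 ≤ x := le_trans (le_max_right _ _) hx
  refine hN x hxN idSys idSys_isNondegenerate (by rw [affLinSize_idSys]; simp) (boxK x)
    (convex_boxK x) (boxK_subset_realBox x) (archMass_idSys_boxK x) 0 (fun _ => 1)
    (fun _ => ⟨one_pos, le_rfl⟩) z ?_
  change fibre 1 u x idSys (boxK x) 0 (fun _ => 1) z = 0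
  rw [← model_sum_eq_fibre u x hx1 z]
  exact hz

/-- Contrapositive, the planner's kill criterion as a theorem. -/
theorem not_fibreHyperbolicity_of_not_cofinalModel (h : ¬ CofinalModelHyperbolicity) :
    ¬ FibreHyperbolicity := fun hFH => h (cofinalModel_of_fibreHyperbolicity hFH)

/-! ### (D) convexity of `K` is load-bearing -/

/-- `N^{1/u} < m` from `N < m^u`. -/
theorem rpow_inv_lt_of_lt_pow {N m : ℝ} {u : ℕ} (hN : 0 ≤ N) (hm : 0 ≤ m) (hu : u ≠ 0)
    (h : N < m ^ u) : N ^ ((1 : ℝ) / u) < m := by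
  by_contra hle
  push Not at hle
  have h1 : m ^ u ≤ (N ^ ((1 : ℝ) / u)) ^ u := pow_le_pow_left₀ hm hle u
  rw [one_div, Real.rpow_inv_natCast_pow hN hu] at h1
  linarith

/-- `t = 1` fibres are one-variable cell polynomials (any `Ψ`, `K`). -/
theorem fibre_t1 (u N : ℕ) (Ψ : Fin 1 → AffLinForm 1) (K : Set (Fin 1 → ℝ)) (w : Fin 1 → ℝ) (z : ℂ) :
    fibre 1 u N Ψ K 0 w z = ∑ m ∈ Finset.Icc 1 u, ((cell 1 u N Ψ K (fun _ => m) : ℕ) : ℂ) * z ^ m := by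
  unfold fibre
  rw [sum_piFinset_fin_one]
  simp

/-- The rough points of a `t = 1` datum whose `Ω` lands in `[1,u]`. -/
def pts1 (u N : ℕ) (Ψ : Fin 1 → AffLinForm 1) (K : Set (Fin 1 → ℝ)) : Finset (Fin 1 → ℤ) :=
  (latticeBox 1 N).filter (fun n => realPoint n ∈ K ∧ (N : ℝ) ^ ((1 : ℝ) / u) <
    (Nat.minFac ((Ψ 0).eval n).toNat : ℝ) ∧
    ArithmeticFunction.cardFactors ((Ψ 0).eval n).toNat ∈ Finset.Icc 1 u)

/-- Sum-over-points form of a `t = 1` fibre: `Σ_{n rough in K, Ω ∈ [1,u]} z^{Ω(ψ(n))}`. -/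
theorem fibre_t1_points (u N : ℕ) (Ψ : Fin 1 → AffLinForm 1) (K : Set (Fin 1 → ℝ)) (w : Fin 1 → ℝ)
    (z : ℂ) : fibre 1 u N Ψ K 0 w z =
      ∑ n ∈ pts1 u N Ψ K, z ^ ArithmeticFunction.cardFactors ((Ψ 0).eval n).toNat := by
  rw [fibre_t1]
  rw [← Finset.sum_fiberwise_of_maps_to (s := pts1 u N Ψ K) (t := Finset.Icc 1 u)
    (g := fun n => ArithmeticFunction.cardFactors ((Ψ 0).eval n).toNat)
    (fun n hn => (Finset.mem_filter.mp hn).2.2.2)]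
  refine Finset.sum_congr rfl fun m hm => ?_
  rw [Finset.sum_congr rfl (g := fun _ => z ^ m) (fun n hn => by rw [(Finset.mem_filter.mp hn).2]),
    Finset.sum_const, nsmul_eq_mul]
  congr 2
  unfold cell pts1
  rw [Finset.filter_filter]
  refine congrArg Finset.card (Finset.filter_congr fun n _ => ?_)
  simp only [Fin.forall_fin_one, Finset.mem_Icc]
  have hm' := Finset.mem_Icc.mp hm
  constructor
  · rintro ⟨hK, hr, hΩ⟩
    exact ⟨⟨hK, hr, by omega⟩, hΩ⟩
  · rintro ⟨⟨hK, hr, -⟩, hΩ⟩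
    exact ⟨hK, hr, hΩ⟩

/-- `realPoint` is injective (integer casts are). [folklore] -/
theorem realPoint_injective : Function.Injective (realPoint (d := 1)) := by
  intro a b h
  funext j
  have := congrFun h j
  simpa [realPoint] using this

/-- `[0,N]` with every lattice point deleted except `P` and `Q` (non-convex, full measure). -/
def puncturedBox (N : ℕ) (P Q : Fin 1 → ℤ) : Set (Fin 1 → ℝ) :=
  {x | x ∈ Set.Icc (0 : Fin 1 → ℝ) (fun _ => (N : ℝ)) ∧
    (x ∉ Set.range (realPoint (d := 1)) ∨ x = realPoint P ∨ x = realPoint Q)}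

/-- The punctured box lies in `[-N,N]`. [folklore] -/
theorem puncturedBox_subset_realBox (N : ℕ) (P Q : Fin 1 → ℤ) :
    puncturedBox N P Q ⊆ realBox 1 N := by
  intro x hx
  refine Set.Icc_subset_Icc ?_ le_rfl hx.1
  intro i
  simp

/-- Lattice points of the punctured box are exactly `P` and `Q` (within `[0,N]`). [folklore] -/
theorem realPoint_mem_puncturedBox {N : ℕ} {P Q n : Fin 1 → ℤ} :
    realPoint n ∈ puncturedBox N P Q ↔
      realPoint n ∈ Set.Icc (0 : Fin 1 → ℝ) (fun _ => (N : ℝ)) ∧ (n = P ∨ n = Q) := by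
  unfold puncturedBox
  simp only [Set.mem_setOf_eq, Set.mem_range, not_exists]
  constructor
  · rintro ⟨h1, h2 | h2 | h2⟩
    · exact absurd rfl (h2 n)
    · exact ⟨h1, Or.inl (realPoint_injective h2)⟩
    · exact ⟨h1, Or.inr (realPoint_injective h2)⟩
  · rintro ⟨h1, h2 | h2⟩
    · exact ⟨h1, Or.inr (Or.inl (by rw [h2]))⟩
    · exact ⟨h1, Or.inr (Or.inr (by rw [h2]))⟩

/-- The punctured box has the same positive-part volume as `[0,N]`: `β_∞ = N`. -/
theorem archFactor_idSys_puncturedBox (N : ℕ) (P Q : Fin 1 → ℤ) :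
    archFactor idSys (puncturedBox N P Q) = N := by
  unfold archFactor
  have hB : volume (Set.pi Set.univ (fun _ : Fin 1 => Set.Ioc (0 : ℝ) N)) = ENNReal.ofReal N := by
    rw [Real.volume_pi_Ioc]; simp
  have hnull : volume (Set.range (realPoint (d := 1))) = 0 :=
    (Set.countable_range _).measure_zero _
  have hae : ((puncturedBox N P Q ∩ {x | ∀ i, 0 < (idSys i).realEval x} : Set (Fin 1 → ℝ))) =ᵐ[volume]
      (Set.pi Set.univ (fun _ : Fin 1 => Set.Ioc (0 : ℝ) N) : Set (Fin 1 → ℝ)) := by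
    rw [ae_eq_set]
    constructor
    · apply measure_mono_null _ (measure_empty (μ := volume))
      rintro x ⟨⟨⟨hxIcc, -⟩, hxpos⟩, hxnB⟩
      apply hxnB
      simp only [Set.mem_Icc, Pi.le_def, Pi.zero_apply, Fin.forall_fin_one] at hxIcc
      simp only [Set.mem_setOf_eq, idSys_realEval, Fin.forall_fin_one] at hxpos
      simp only [Set.mem_pi, Set.mem_univ, true_implies, Set.mem_Ioc, Fin.forall_fin_one]
      exact ⟨hxpos, hxIcc.2⟩
    · apply measure_mono_null _ hnull
      rintro x ⟨hxB, hxnA⟩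
      simp only [Set.mem_pi, Set.mem_univ, true_implies, Set.mem_Ioc, Fin.forall_fin_one] at hxB
      by_contra hxr
      apply hxnA
      refine ⟨⟨⟨?_, ?_⟩, Or.inl hxr⟩, ?_⟩
      · intro i; have := Subsingleton.elim i 0; subst this; exact hxB.1.le
      · intro i; have := Subsingleton.elim i 0; subst this; exact hxB.2
      · simp only [Set.mem_setOf_eq, idSys_realEval]
        intro i; exact hxB.1
  rw [measure_congr hae, hB]
  simp

/-- Primes for the witness: `p ∈ (N/2, N]` and `q` with `q⁴ > N ≥ q³` (Bertrand twice), `N ≥ 4096`, `u ≥ 4`. -/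
theorem exists_witness_primes (N : ℕ) (hN : 4096 ≤ N) (u : ℕ) (hu : 4 ≤ u) :
    ∃ p q : ℕ, p.Prime ∧ q.Prime ∧ p ≤ N ∧ N < p ^ u ∧ q ^ 3 ≤ N ∧ N < q ^ u := by
  -- p
  obtain ⟨p, hp, hp1, hp2⟩ := Nat.exists_prime_lt_and_le_two_mul (N / 2) (by omega)
  -- q
  set r := Nat.sqrt (Nat.sqrt N) with hr
  have hs64 : 64 ≤ Nat.sqrt N := Nat.le_sqrt.mpr (by omega)
  have hr8 : 8 ≤ r := Nat.le_sqrt.mpr (by omega)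
  obtain ⟨q, hq, hq1, hq2⟩ := Nat.exists_prime_lt_and_le_two_mul r (by omega)
  have hr2 : r ^ 2 ≤ Nat.sqrt N := Nat.sqrt_le' _
  have hsN : Nat.sqrt N ^ 2 ≤ N := Nat.sqrt_le' _
  have hr4 : r ^ 4 ≤ N := by
    calc r ^ 4 = (r ^ 2) ^ 2 := by ring
      _ ≤ (Nat.sqrt N) ^ 2 := Nat.pow_le_pow_left hr2 2
      _ ≤ N := hsN
  have hN1 : N < (Nat.sqrt N + 1) ^ 2 := Nat.lt_succ_sqrt' N
  have hN2 : Nat.sqrt N < (r + 1) ^ 2 := Nat.lt_succ_sqrt' (Nat.sqrt N)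
  have hN3 : N < (r + 1) ^ 4 := by
    have : Nat.sqrt N + 1 ≤ (r + 1) ^ 2 := hN2
    calc N < (Nat.sqrt N + 1) ^ 2 := hN1
      _ ≤ ((r + 1) ^ 2) ^ 2 := Nat.pow_le_pow_left this 2
      _ = (r + 1) ^ 4 := by ring
  refine ⟨p, q, hp, hq, by omega, ?_, ?_, ?_⟩
  · have hp2' : 2 ≤ p := hp.two_le
    have h1 : p ^ 2 ≤ p ^ u := Nat.pow_le_pow_right hp.pos (by omega)
    have h2 : N < 2 * p := by omega
    have h3 : 2 * p ≤ p ^ 2 := by nlinarith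
    omega
  · have h1 : q ^ 3 ≤ (2 * r) ^ 3 := Nat.pow_le_pow_left hq2 3
    have h2 : (2 * r) ^ 3 = 8 * r ^ 3 := by ring
    have h3 : 8 * r ^ 3 ≤ r ^ 4 := by
      calc 8 * r ^ 3 ≤ r * r ^ 3 := Nat.mul_le_mul_right _ hr8
        _ = r ^ 4 := by ring
    omega
  · have h1 : (r + 1) ^ 4 ≤ q ^ 4 := Nat.pow_le_pow_left (by omega) 4
    have h2 : q ^ 4 ≤ q ^ u := Nat.pow_le_pow_right hq.pos hu
    omega

/-- The fibre of (`ψ(n) = n`, punctured box keeping a prime `p` and a prime cube `q³`) is `ζ + ζ³`,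
so it vanishes at `ζ = I`. -/
theorem fibre_punctured_I {u N p q : ℕ} (hu : 3 ≤ u) (hp : p.Prime) (hq : q.Prime) (hpN : p ≤ N)
    (hpr : N < p ^ u) (hqN : q ^ 3 ≤ N) (hqr : N < q ^ u) (w : Fin 1 → ℝ) :
    fibre 1 u N idSys (puncturedBox N (fun _ => (p : ℤ)) (fun _ => ((q ^ 3 : ℕ) : ℤ))) 0 w
      Complex.I = 0 := by
  set P : Fin 1 → ℤ := fun _ => (p : ℤ) with hP
  set Q : Fin 1 → ℤ := fun _ => ((q ^ 3 : ℕ) : ℤ) with hQ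
  have hu0 : u ≠ 0 := by omega
  have hPQ : P ≠ Q := by
    intro h
    have h' : (p : ℤ) = ((q ^ 3 : ℕ) : ℤ) := congrFun h 0
    have h'' : p = q ^ 3 := by exact_mod_cast h'
    rcases hp.eq_one_or_self_of_dvd q (Dvd.intro (q ^ 2) (by rw [h'']; ring)) with h1 | h1
    · exact hq.one_lt.ne' h1
    · subst h1
      have : q < q ^ 3 := by
        calc q = q ^ 1 := (pow_one q).symm
          _ < q ^ 3 := Nat.pow_lt_pow_right hq.one_lt (by norm_num)
      omega
  -- the point set is {P, Q}
  have hpts : pts1 u N idSys (puncturedBox N P Q) = {P, Q} := by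
    ext n
    simp only [pts1, Finset.mem_filter, latticeBox, Fintype.mem_piFinset, Finset.mem_Icc,
      Fin.forall_fin_one, idSys_eval, realPoint_mem_puncturedBox, Finset.mem_insert,
      Finset.mem_singleton, Set.mem_Icc, Pi.le_def, Pi.zero_apply, realPoint]
    constructor
    · rintro ⟨-, ⟨-, h⟩, -⟩
      exact h
    · rintro (rfl | rfl)
      · refine ⟨⟨by simp [hP], by simp [hP]; exact_mod_cast hpN⟩, ⟨⟨by simp [hP], by simp [hP]; exact_mod_cast hpN⟩, Or.inl rfl⟩, ?_, ?_⟩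
        · simp only [hP, Int.toNat_natCast, hp.minFac_eq]
          exact rpow_inv_lt_of_lt_pow (by positivity) (by positivity) hu0 (by exact_mod_cast hpr)
        · simp only [hP, Int.toNat_natCast, ArithmeticFunction.cardFactors_apply_prime hp]
          omega
      · refine ⟨⟨by simp [hQ]; exact le_trans (neg_nonpos.mpr (by positivity)) (by positivity),
          by simp [hQ]; exact_mod_cast hqN⟩, ⟨⟨by simp [hQ], by simp [hQ]; exact_mod_cast hqN⟩, Or.inr rfl⟩, ?_, ?_⟩
        · simp only [hQ, Int.toNat_natCast, hq.pow_minFac (by norm_num : (3 : ℕ) ≠ 0)]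
          exact rpow_inv_lt_of_lt_pow (by positivity) (by positivity) hu0 (by exact_mod_cast hqr)
        · simp only [hQ, Int.toNat_natCast, ArithmeticFunction.cardFactors_apply_prime_pow hq]
          omega
  rw [fibre_t1_points, hpts, Finset.sum_pair hPQ]
  simp only [hP, hQ, idSys_eval, Int.toNat_natCast, ArithmeticFunction.cardFactors_apply_prime hp,
    ArithmeticFunction.cardFactors_apply_prime_pow hq, pow_one]
  rw [pow_succ, Complex.I_sq]
  ring

/-- The crux with `Convex ℝ K` deleted. -/
def WithoutConvexity : Prop :=
  ∀ (t L u₀ : ℕ), 1 ≤ t → ∀ η : ℝ, 0 < η → ∃ u : ℕ, u₀ ≤ u ∧ 2 ≤ u ∧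
    ∃ N₀ : ℕ, ∀ N : ℕ, N₀ ≤ N → ∀ Ψ : Fin t → AffLinForm 1, IsNondegenerateSystem Ψ →
    affLinSize Ψ N ≤ L → ∀ K : Set (Fin 1 → ℝ), K ⊆ realBox 1 N →
    η * (N : ℝ) ≤ archFactor Ψ K * singularProduct Ψ → ∀ i : Fin t, ∀ w : Fin t → ℝ,
    (∀ k, 0 < w k ∧ w k ≤ 1) → ∀ ζ : ℂ, fibre t u N Ψ K i w ζ = 0 → ζ.im = 0

/-- **Load-bearing (d).** Without convexity of `K` the statement is false: `t = 1`, `ψ(n) = n`,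
`u₀ = 4`, `η = 1`, and `K = [0,N]` punctured at every lattice point except a prime `p ∈ (N/2, N]` and
a prime cube `q³ ≤ N < q⁴` (Bertrand twice, `N ≥ 4096`): `K ⊆ [-N,N]`, `β_∞ = N`, `𝔖 = 1`, both kept
points are `N^{1/u}`-rough with `Ω = 1, 3`, so the fibre is `ζ + ζ³ = ζ(1 + ζ²)` with the root `I`.
Any proof must use that `K ∩ ℤ` is an interval of integers. -/
theorem false_without_convexity : ¬ WithoutConvexity := by
  intro h
  obtain ⟨u, hu4, -, N₀, hN⟩ := h 1 1 4 le_rfl 1 one_pos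
  obtain ⟨p, q, hp, hq, hpN, hpr, hqN, hqr⟩ :=
    exists_witness_primes (max N₀ 4096) (le_max_right _ _) u hu4
  have key := hN (max N₀ 4096) (le_max_left _ _) idSys idSys_isNondegenerate
    (by rw [affLinSize_idSys]; simp) _ (puncturedBox_subset_realBox _ _ _)
    (by rw [archFactor_idSys_puncturedBox, singularProduct_idSys]; simp) 0 (fun _ => 1)
    (fun _ => ⟨one_pos, le_rfl⟩) Complex.I (fibre_punctured_I (by omega) hp hq hpN hpr hqN hqr _)
  simp at key


/-! ### (T) finite-`N` noise: the `∃ N₀` is load-bearing (explicit toy) -/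

/-- **Toy non-hyperbolic fibre.** For `Ψ = (n, n+2)`, `u = 4`, `N = 130`, `K = [100,130]` the rough pairs
are `n ∈ {101, 107, 113, 119, 125}` (`N^{1/4} ≈ 3.38`, so "rough" = coprime to `6`; `113+2 = 5·23`,
`119 = 7·17`, `121 = 11²`, `125 = 5³`, `127` prime), giving the cells
`{(1,1):2, (1,2):1, (2,2):1, (3,1):1}` (hand- and machine-checked outside Lean) and, on the fibre
`i = 1`, the polynomial `2ζw + ζw² + ζ²w² + ζ³w = wζ(ζ² + wζ + 2 + w)` whose discriminant
`w² − 4w − 8` is negative for every `w ∈ (0,1]`: non-real zeros for the WHOLE fugacity range although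
`β_∞𝔖 ≈ 30·1.32 ≥ 0.3·130`.  So the crux with `N₀ ≤ 130` fails at `(t,L,u,η) = (2,3,4,3/10)`; in the
HL world `N₀(u)` must beat the robustness margin `δ(u) ≈ 10^{-0.4u}` of the model polynomial
(a tower `exp(10^{0.4u/A})` under `(log N)^{-A}` savings).  This lemma is the algebra of the pattern. -/
theorem toy_fibre_nonreal (w : ℝ) (hw0 : 0 < w) (hw1 : w ≤ 1) :
    ∃ ζ : ℂ, ζ.im ≠ 0 ∧
      (2 : ℂ) * ζ * w + ζ * (w : ℂ) ^ 2 + ζ ^ 2 * (w : ℂ) ^ 2 + ζ ^ 3 * w = 0 := by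
  have hpos : 0 < 8 + 4 * w - w ^ 2 := by nlinarith
  set s : ℝ := Real.sqrt (8 + 4 * w - w ^ 2) with hs
  have hs2 : s ^ 2 = 8 + 4 * w - w ^ 2 := by rw [hs, Real.sq_sqrt hpos.le]
  have hs0 : 0 < s := Real.sqrt_pos.mpr hpos
  set ζ : ℂ := ⟨-w / 2, s / 2⟩ with hζ
  have key : ζ ^ 2 + (w : ℂ) * ζ + (2 + (w : ℂ)) = 0 := by
    rw [Complex.ext_iff]
    simp only [hζ, sq, Complex.add_re, Complex.mul_re, Complex.ofReal_re, Complex.ofReal_im,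
      Complex.add_im, Complex.mul_im, Complex.zero_re, Complex.zero_im]
    norm_num
    constructor <;> nlinarith [hs2]
  refine ⟨ζ, ?_, ?_⟩
  · simp only [hζ]
    exact hs0.ne' ∘ (by intro h; linarith)
  · linear_combination (w : ℂ) * ζ * key

/-! ### Line `SketchIdeator1` (MODEL TRANSFER, picked 2026-08-16T10:30Z) — disprover's audit of the stub set

State read from `Cruxes/FibreHyperbolicity/Lines/SketchIdeator1.lean` (v6) and `PICKED.md`: every registered stub is
LANDED except `stub_ghostFree : ∀ t ≥ 2, GhostFreeCellLaw t`; `fibreHyperbolicityAt_one` (the crux at `t = 1`) is an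
unconditional theorem (p90926), and crux 4 is PROVED (`WindowChainTransport.ModelHyperbolicity_of`: Hermite–Biehler
positivity pair transported along the Buchstab delay equation — the "interlacing along the recursion" the route hoped
for).  Consequences for this file: the kill criterion (C) can no longer fire (its hypothesis `¬ CofinalModelHyperbolicity`
is now refuted in the tree), and the cycle-1 verdict stands sharpened: the crux is CLOSED MODULO the ghost-free
Hardy–Littlewood law for joint rough Ω-cells at `t ≥ 2`, exactly the parity-sensitive content identified in §1 of
`DisproofAnalysis.md`.

Attack on the open stub `GhostFreeCellLaw t` (`t ≥ 2`; typing read in `…GhostFree.lean`: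
`|C_j − β_∞·𝔖·∏_i A_{j_i}(N)/N| ≤ εN/log^t N`, all `j ∈ [1,u]^t`, all convex `K ⊆ [-N,N]`, NO mass hypothesis):
* top cells `j_i = u` (model `A_u(N) = 0`, true cells fed by values in `(N, LN]`): `C_j ≲ N(u log L/log N)^u/log^{t-1}N
  = o(N/log^t N)` — absorbed by the absolute error; not a misstatement.
* value scale `≤ LN` versus model scale `N`: relative density drift `O(u² log L/log N)`, absolute
  `𝔖N·u² log L/log^{t+1} N = o(εN/log^t N)` since `𝔖 ≤ C(log log N)^{t-1}` — absorbed.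
* no mass hypothesis: for `vol K ≤ εN/(2 log^t N)` both `C_j` and the model are below the error; the non-trivial range is
  `vol K ≍ N` — the standard HL regime; fine.
* product model versus truth: `(li N)²/N` vs `li₂(N)`-type discrepancies are relative `O(1/log² N)`, and the
  `j`-dependent secondary terms relative `O(1/log N)`; absolute `O(𝔖N/log^{t+1} N) = o(εN/log^t N)` — absorbed
  (this is WHY the absolute error form is the right typing; a relative-ε law would be false at order `1/log N`).
* shared large prime factors of two forms (`p | a₁b₂ − a₂b₁`, `p > N^{1/u}`): relative effect `O(N^{-1/u})` — negligible.
* Siegel zeros: for `Ψ = (n, n+q)`, `q` exceptional, `N` in the Siegel range the prime-pair cells are biased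
  (`θ₁₂ → +1`), so the stub is false in a Siegel world — a proof must exclude exceptional zeros (known caveat,
  MatomakiMerikoski2023); not an unconditional refutation.
VERDICT: no misstatement found; `stub_ghostFree` is Hardy–Littlewood-complete (it contains the rough prime `t`-tuple
asymptotics uniformly in shifts `≤ LN`) and is the honest residue.  No `stub_*_false` lemma is possible here without
disproving Hardy–Littlewood. -/

end Summit.Parity.GeneralizedHardyLittlewood.Cruxes.FibreHyperbolicity.Disproof
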